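/-
Copyright (c) 2026. All rights reserved.
Released under Apache 2.0 license as described in the file LICENSE.
-/
import Literature.NumberTheory.Weil1964.ArchDualPairThetaMajorantsInr
import HarnessLib

/-!
# Lemme 5 for the second factor `1 × U(W)` — the consumer's forms: one sign fact on `t_W`, the CM pin, the
# hermitian plane

Sequel of `ArchDualPairThetaMajorantsInr` (Weil's theta majorants ∕ Lemme 5 [Weil1964, Chap. III n° 41 p. 193–194]
for the SECOND factor `u ↦ ω_ψ(s_pair(1, u))` of the diagonal unitary dual pair of [GelbartRogawski1991] §3.1, with
NO condition on `V`).  Here the sign frames and scalings are chosen inside the proofs, so the statements carry no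
frame data:

* §1 generic `E/F` (`F` totally real, ANY continuous compatible splitting `s`):
  `hasThetaMajorants_omega_pairSplitting_inr_of_signs` ∕ `exists_piSchwartzBruhat_dominating_omega_pairSplitting_inr_of_signs`
  — hypothesis: at every real place `v`, all but at most one of the real numbers `σ_v(t_W j)` have a common strict sign
  (`U(W_v)` of real rank `≤ 1`); nothing on `t_V`;
* §2 the CM pin (`F = L⁺`, `E = L`, the chosen splitting `cmPairSplitting` of `UnitaryDualPairThetaKernelCM`):
  `hasThetaMajorants_cmPairSplitting_inr_of_signs` ∕ `exists_piSchwartzBruhat_dominating_cmPairSplitting_inr_of_signs`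
  — the same sign fact read through the complex embeddings of `L`;
* §3 a hermitian PLANE `W` (`M = 2`, e.g. the doubled line `W ⊕ W⁻` of the Siegel–Weil ∕ Rallis engine):
  `hasThetaMajorants_cmPairSplitting_inr_two` ∕ **`exists_piSchwartzBruhat_dominating_cmPairSplitting_inr_two` — NO
  SIGN HYPOTHESIS AT ALL** (a real binary hermitian form has real rank `≤ 1`).

Cell hodgecm-mathlib FLOOR 0, engine E-2 (crux item H413), input (DOM-C) of the `SW2c-BOUND` assembly on Weil's
Lemme 20 [Weil1965, Chap. V n° 47, n° 50].  HC_CM is proved only modulo the printed citations until rung 0 closes;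
nothing here is about Hodge classes.  Everything is proved; no definition, no cited statement enters as a hypothesis.

## References

* [Weil1964] A. Weil, Acta Math. 111 (1964), Chap. III n° 41, Lemme 5 p. 194, Théorème 6 (1) p. 193.
* [Weil1965] A. Weil, Acta Math. 113 (1965), Chap. V n° 47 Lemme 20, n° 50.
* [GelbartRogawski1991] S. Gelbart, J. Rogawski, Invent. Math. 105 (1991), §3.1 Prop. 3.1.1 p. 455.
* [KonnoKonno2007] K. Konno, T. Konno, Kyushu J. Math. 61 (2007), §3.1 (3.1).
* [MoeglinVignerasWaldspurger1987] C. Mœglin, M.-F. Vignéras, J.-L. Waldspurger, LNM 1291 (1987), Ch. 1 I.17.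
* [Folland1989] G. B. Folland, *Harmonic Analysis in Phase Space* (1989), §4.2 (4.24) p. 156, Prop. (4.39).
* [Knapp2002] A. W. Knapp, *Lie Groups Beyond an Introduction*, 2nd ed. (2002), Thm 7.39.
-/

noncomputable section

open scoped Matrix Real Classical ComplexConjugate
open Complex NumberField NumberField.InfinitePlace NumberField.mixedEmbedding IsDedekindDomain
open Literature.NumberTheory.Automorphic Literature.NumberTheory.Automorphic.UnitaryGroup
open Literature.RepresentationTheory.HeisenbergGroup Literature.Analysis.SegalBargmann
open Literature.RepresentationTheory.KonnoKonno2007 Literature.RepresentationTheory.KonnoKonno2007.RealDualPair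

namespace Literature.NumberTheory.Weil1964

/-! ## §1 Generic `E/F`: one sign fact on `t_W` per real place -/

section Pair

variable {F : Type} [Field F] [NumberField F] (E : Type) [Field E] [NumberField E] [Algebra F E] (c : E ≃ₐ[F] E)
  (N M : ℕ) {m : ℕ} (e : Fin N × Fin M ≃ Fin m)
  (tV : Fin N → F) (tW : Fin M → F) {JV : Matrix (Fin N) (Fin N) E} {JW : Matrix (Fin M) (Fin M) E}
  (hJV : JV = (Matrix.diagonal tV).map (algebraMap F E)) (hJW : JW = (Matrix.diagonal tW).map (algebraMap F E))
  [IsTotallyReal F] [Algebra.IsQuadraticExtension F E] {δ : E} (hcδ : c δ = -δ) (hδ : δ ≠ 0) {d : F}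
  (hd : δ * δ = algebraMap F E d) (hV : (Matrix.diagonal tV).IsSymm) (hW : (Matrix.diagonal tW).IsSymm)

/-- **Theta majorants for the second factor from ONE SIGN FACT ON `t_W` PER REAL PLACE** (no frames, no scalings, no
`KAK` data, nothing on `t_V`): if at every real place `v` of `F` all but at most one of the `σ_v(t_W j)` have a
common strict sign (`U(W_v)` of real rank `≤ 1`), then `u ↦ ω_ψ(s_pair(1, u))`, `u ∈ U(J_W)(𝔸_F)`,
`HasThetaMajorants`, for every continuous compatible splitting `s`.
[cite: Weil1964, Chap. III n° 41 Lemme 5 p. 194, Théorème 6 (1) p. 193]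
[cite: GelbartRogawski1991, §3.1 Prop. 3.1.1 p. 455]
[cite: KonnoKonno2007, §3.1 (3.1)]
[cite: MoeglinVignerasWaldspurger1987, Ch. 1 I.17]
[cite: Folland1989, §4.2 (4.24)–(4.26) pp. 177–178, Prop. (4.39) pp. 183–184]
[cite: Knapp2002, Thm 7.39] -/
theorem hasThetaMajorants_omega_pairSplitting_inr_of_signs (hc : c ≠ 1)
    (wOf : {v : InfinitePlace F // v.IsReal} → {w : InfinitePlace E // w.IsComplex})
    (hw : ∀ v, c • (wOf v).1 = (wOf v).1) (hover : ∀ v, (wOf v).1.comap (algebraMap F E) = v.1)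
    (hVd : IsUnit (Matrix.diagonal tV).det) (hWd : IsUnit (Matrix.diagonal tW).det)
    (hrk : ∀ v : {v : InfinitePlace F // v.IsReal}, ∃ j₀ : Fin M,
      (∀ j, j ≠ j₀ → 0 < embedding_of_isReal v.2 (tW j)) ∨ ∀ j, j ≠ j₀ → embedding_of_isReal v.2 (tW j) < 0)
    {s : UnitaryGroup.adelicPair F E c N M JV JW →* adelicMpCont F (Fin m)
      (GelbartRogawski1991.UnitaryDualPair.adelicGram F e (Matrix.diagonal tV) (Matrix.diagonal tW))}
    (hs : (GelbartRogawski1991.UnitaryDualPair.splittingDatum F E c N M e JV JW hcδ hδ hd hV hW hVd hWd hJV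
      hJW).IsCompatible s)
    (hsc : Continuous s) :
    HasThetaMajorants (F := F) fun (u : UnitaryGroup.adelic F E c M JW) Φ => adelicMpCont.omega F (Fin m)
      (GelbartRogawski1991.UnitaryDualPair.adelicGram F e (Matrix.diagonal tV) (Matrix.diagonal tW))
      (GelbartRogawski1991.UnitaryDualPair.pairSplitting F E c N M e JV JW s (1, u)) Φ := by
  have hδv : ∀ v : {v : InfinitePlace F // v.IsReal}, ((wOf v).1.embedding δ).im ≠ 0 := fun v =>
    UnitaryGroup.im_embedding_delta_ne_zero F E c (wOf v) (hw v) hc hcδ hδ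
  have htV0 : ∀ (v : {v : InfinitePlace F // v.IsReal}) i, embedding_of_isReal v.2 (tV i) ≠ 0 := fun v i =>
    (map_ne_zero _).2 (ne_zero_of_isUnit_det_diagonal hVd i)
  have htW0 : ∀ (v : {v : InfinitePlace F // v.IsReal}) j, embedding_of_isReal v.2 (tW j) ≠ 0 := fun v j =>
    (map_ne_zero _).2 (ne_zero_of_isUnit_det_diagonal hWd j)
  choose j₀ hj₀ using hrk
  -- the sign convention on the first factor: `c_V(v) := ± im σ_{w(v)}(δ)`, so that `c_W(v) = im σ_{w(v)}(δ)/c_V(v) = ±1`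
  -- makes `σ_v(t_W j) / c_W(v)` positive off `j₀ v`; `V` is split by whatever signs result (no condition).
  let cV : {v : InfinitePlace F // v.IsReal} → ℝ := fun v =>
    if ∀ j, j ≠ j₀ v → 0 < embedding_of_isReal v.2 (tW j) then ((wOf v).1.embedding δ).im
    else -((wOf v).1.embedding δ).im
  have hcV : ∀ v, cV v ≠ 0 := fun v => by
    by_cases h : ∀ j, j ≠ j₀ v → 0 < embedding_of_isReal v.2 (tW j)
    · simp only [cV, if_pos h]; exact hδv v
    · simp only [cV, if_neg h]; exact neg_ne_zero.2 (hδv v)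
  have hy : ∀ v, ∃ j₁, ∀ j, j ≠ j₁ →
      0 < placeSignVec tW (fun v => ((wOf v).1.embedding δ).im / cV v) v j := fun v => by
    refine ⟨j₀ v, fun j hj => ?_⟩
    show 0 < embedding_of_isReal v.2 (tW j) / (((wOf v).1.embedding δ).im / cV v)
    by_cases h : ∀ j, j ≠ j₀ v → 0 < embedding_of_isReal v.2 (tW j)
    · have hc1 : ((wOf v).1.embedding δ).im / cV v = 1 := by simp only [cV, if_pos h]; exact div_self (hδv v)
      rw [hc1, div_one]
      exact h j hj
    · have hc1 : ((wOf v).1.embedding δ).im / cV v = -1 := by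
        simp only [cV, if_neg h]; rw [div_neg, div_self (hδv v)]
      rw [hc1, div_neg, div_one, neg_pos]
      exact ((hj₀ v).resolve_left h) j hj
  exact hasThetaMajorants_omega_pairSplitting_inr E c N M e tV tW hJV hJW hcδ hδ hd hV hW hc wOf hw hover
    (fun v => signSplit (placeSignVec tV cV v))
    (fun v => signSplit (placeSignVec tW (fun v => ((wOf v).1.embedding δ).im / cV v) v))
    (DV := fun v => sqrtAbs (placeSignVec tV cV v))
    (DW := fun v => sqrtAbs (placeSignVec tW (fun v => ((wOf v).1.embedding δ).im / cV v) v))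
    (fun v i => sqrtAbs_ne_zero (div_ne_zero (htV0 v i) (hcV v)))
    (fun v j => sqrtAbs_ne_zero (div_ne_zero (htW0 v j) (div_ne_zero (hδv v) (hcV v))))
    (cV := cV) (cW := fun v => ((wOf v).1.embedding δ).im / cV v) hcV
    (fun v => div_ne_zero (hδv v) (hcV v))
    (fun v i => eq_mul_signOf_signSplit_mul_sqrtAbs_sq (hcV v) (fun j => embedding_of_isReal v.2 (tV j)) i
      (htV0 v i))
    (fun v j => eq_mul_signOf_signSplit_mul_sqrtAbs_sq (div_ne_zero (hδv v) (hcV v))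
      (fun j => embedding_of_isReal v.2 (tW j)) j (htW0 v j))
    (fun v => by rw [← mul_div_assoc, mul_div_cancel_left₀ _ (hcV v)]) hVd hWd
    (fun v => (Classical.choice (nonempty_anyLeviKAKInput_inr_of_signs (placeSignVec tV cV v)
      (Or.inl (hy v)))).input) hs hsc

/-- **Lemme 5 for the second factor from ONE SIGN FACT ON `t_W` PER REAL PLACE — the consumer's form (no frames, no
scalings, no `KAK` data, nothing on `t_V`).**  Hypothesis: at every real place `v` of `F`, all but at most one of the
real numbers `σ_v(t_W j)` have a common strict sign (`U(W_v)` of real rank `≤ 1`: signature `(M,0)`, `(0,M)`,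
`(M−1,1)` or `(1,M−1)`); `V` is ARBITRARY.  Conclusion: on every compact `C ⊆ U(J_W)(𝔸_F)` the functions
`ω_ψ(s_pair(1, u))Φ`, `u ∈ C`, are dominated by ONE real non-negative `Φ₀ ∈ 𝒮(𝔸_Fⁿ)`.
[cite: Weil1964, Chap. III n° 41, Lemme 5 p. 194]
[cite: Weil1965, Chap. V n° 47, n° 50]
[cite: GelbartRogawski1991, §3.1 Prop. 3.1.1 p. 455]
[cite: KonnoKonno2007, §3.1 (3.1)]
[cite: MoeglinVignerasWaldspurger1987, Ch. 1 I.17]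
[cite: Folland1989, §4.2 (4.24)–(4.26) pp. 177–178, Prop. (4.39) pp. 183–184]
[cite: Knapp2002, Thm 7.39] -/
theorem exists_piSchwartzBruhat_dominating_omega_pairSplitting_inr_of_signs (hc : c ≠ 1)
    (wOf : {v : InfinitePlace F // v.IsReal} → {w : InfinitePlace E // w.IsComplex})
    (hw : ∀ v, c • (wOf v).1 = (wOf v).1) (hover : ∀ v, (wOf v).1.comap (algebraMap F E) = v.1)
    (hVd : IsUnit (Matrix.diagonal tV).det) (hWd : IsUnit (Matrix.diagonal tW).det)
    (hrk : ∀ v : {v : InfinitePlace F // v.IsReal}, ∃ j₀ : Fin M,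
      (∀ j, j ≠ j₀ → 0 < embedding_of_isReal v.2 (tW j)) ∨ ∀ j, j ≠ j₀ → embedding_of_isReal v.2 (tW j) < 0)
    {s : UnitaryGroup.adelicPair F E c N M JV JW →* adelicMpCont F (Fin m)
      (GelbartRogawski1991.UnitaryDualPair.adelicGram F e (Matrix.diagonal tV) (Matrix.diagonal tW))}
    (hs : (GelbartRogawski1991.UnitaryDualPair.splittingDatum F E c N M e JV JW hcδ hδ hd hV hW hVd hWd hJV
      hJW).IsCompatible s)
    (hsc : Continuous s) (Φ : piSchwartzBruhat F (Fin m)) {C : Set (UnitaryGroup.adelic F E c M JW)}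
    (hC : IsCompact C) :
    ∃ Φ₀ : (Fin m → AdeleRing (𝓞 F) F) → ℂ, Φ₀ ∈ piSchwartzBruhat F (Fin m) ∧
      (∀ x, (Φ₀ x).im = 0 ∧ 0 ≤ (Φ₀ x).re) ∧
        ∀ u ∈ C, ∀ x, ‖((adelicMpCont.omega F (Fin m)
          (GelbartRogawski1991.UnitaryDualPair.adelicGram F e (Matrix.diagonal tV) (Matrix.diagonal tW))
          (GelbartRogawski1991.UnitaryDualPair.pairSplitting F E c N M e JV JW s (1, u)) Φ :
            piSchwartzBruhat F (Fin m)) : (Fin m → AdeleRing (𝓞 F) F) → ℂ) x‖ ≤ (Φ₀ x).re := by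
  have hδv : ∀ v : {v : InfinitePlace F // v.IsReal}, ((wOf v).1.embedding δ).im ≠ 0 := fun v =>
    UnitaryGroup.im_embedding_delta_ne_zero F E c (wOf v) (hw v) hc hcδ hδ
  have htV0 : ∀ (v : {v : InfinitePlace F // v.IsReal}) i, embedding_of_isReal v.2 (tV i) ≠ 0 := fun v i =>
    (map_ne_zero _).2 (ne_zero_of_isUnit_det_diagonal hVd i)
  have htW0 : ∀ (v : {v : InfinitePlace F // v.IsReal}) j, embedding_of_isReal v.2 (tW j) ≠ 0 := fun v j =>
    (map_ne_zero _).2 (ne_zero_of_isUnit_det_diagonal hWd j)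
  choose j₀ hj₀ using hrk
  -- the sign convention on the first factor: `c_V(v) := ± im σ_{w(v)}(δ)`, so that `c_W(v) = im σ_{w(v)}(δ)/c_V(v) = ±1`
  -- makes `σ_v(t_W j) / c_W(v)` positive off `j₀ v`; `V` is split by whatever signs result (no condition).
  let cV : {v : InfinitePlace F // v.IsReal} → ℝ := fun v =>
    if ∀ j, j ≠ j₀ v → 0 < embedding_of_isReal v.2 (tW j) then ((wOf v).1.embedding δ).im
    else -((wOf v).1.embedding δ).im
  have hcV : ∀ v, cV v ≠ 0 := fun v => by
    by_cases h : ∀ j, j ≠ j₀ v → 0 < embedding_of_isReal v.2 (tW j)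
    · simp only [cV, if_pos h]; exact hδv v
    · simp only [cV, if_neg h]; exact neg_ne_zero.2 (hδv v)
  have hy : ∀ v, ∃ j₁, ∀ j, j ≠ j₁ →
      0 < placeSignVec tW (fun v => ((wOf v).1.embedding δ).im / cV v) v j := fun v => by
    refine ⟨j₀ v, fun j hj => ?_⟩
    show 0 < embedding_of_isReal v.2 (tW j) / (((wOf v).1.embedding δ).im / cV v)
    by_cases h : ∀ j, j ≠ j₀ v → 0 < embedding_of_isReal v.2 (tW j)
    · have hc1 : ((wOf v).1.embedding δ).im / cV v = 1 := by simp only [cV, if_pos h]; exact div_self (hδv v)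
      rw [hc1, div_one]
      exact h j hj
    · have hc1 : ((wOf v).1.embedding δ).im / cV v = -1 := by
        simp only [cV, if_neg h]; rw [div_neg, div_self (hδv v)]
      rw [hc1, div_neg, div_one, neg_pos]
      exact ((hj₀ v).resolve_left h) j hj
  exact exists_piSchwartzBruhat_dominating_omega_pairSplitting_inr E c N M e tV tW hJV hJW hcδ hδ hd hV hW hc wOf hw
    hover (fun v => signSplit (placeSignVec tV cV v))
    (fun v => signSplit (placeSignVec tW (fun v => ((wOf v).1.embedding δ).im / cV v) v))
    (DV := fun v => sqrtAbs (placeSignVec tV cV v))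
    (DW := fun v => sqrtAbs (placeSignVec tW (fun v => ((wOf v).1.embedding δ).im / cV v) v))
    (fun v i => sqrtAbs_ne_zero (div_ne_zero (htV0 v i) (hcV v)))
    (fun v j => sqrtAbs_ne_zero (div_ne_zero (htW0 v j) (div_ne_zero (hδv v) (hcV v))))
    (cV := cV) (cW := fun v => ((wOf v).1.embedding δ).im / cV v) hcV
    (fun v => div_ne_zero (hδv v) (hcV v))
    (fun v i => eq_mul_signOf_signSplit_mul_sqrtAbs_sq (hcV v) (fun j => embedding_of_isReal v.2 (tV j)) i
      (htV0 v i))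
    (fun v j => eq_mul_signOf_signSplit_mul_sqrtAbs_sq (div_ne_zero (hδv v) (hcV v))
      (fun j => embedding_of_isReal v.2 (tW j)) j (htW0 v j))
    (fun v => by rw [← mul_div_assoc, mul_div_cancel_left₀ _ (hcV v)]) hVd hWd
    (fun v => (Classical.choice (nonempty_anyLeviKAKInput_inr_of_signs (placeSignVec tV cV v)
      (Or.inl (hy v)))).input) hs hsc Φ hC

end Pair

/-! ## §2 The CM pin: the sign fact through complex embeddings of `L` -/

section CM

variable (L : Type) [Field L] [NumberField L] [IsCMField L] {N M n : ℕ} (e : Fin N × Fin M ≃ Fin n)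
  (dV : Fin N → L) (hdV : ∀ i, IsCMField.complexConj L (dV i) = dV i) (hdV0 : ∀ i, dV i ≠ 0)
  (dW : Fin M → L) (hdW : ∀ i, IsCMField.complexConj L (dW i) = dW i) (hdW0 : ∀ i, dW i ≠ 0)

/-- the sign fact through complex embeddings gives the sign fact at every real place of `L⁺` (read through THE
complex place over it, `embedding_of_isReal_cmRealVec`). [folklore] -/
private theorem rank_of_embeddings
    (hWr : ∀ τ : L →+* ℂ, ∃ j₀ : Fin M, (∀ j, j ≠ j₀ → 0 < (τ (dW j)).re) ∨ ∀ j, j ≠ j₀ → (τ (dW j)).re < 0)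
    (v : {v : InfinitePlace ↥(maximalRealSubfield L) // v.IsReal}) :
    ∃ j₀ : Fin M, (∀ j, j ≠ j₀ → 0 < embedding_of_isReal v.2 (cmRealVec L dW hdW j)) ∨
      ∀ j, j ≠ j₀ → embedding_of_isReal v.2 (cmRealVec L dW hdW j) < 0 := by
  have hτ : (InfinitePlace.mk (cmPlaceOver L v).1.embedding).comap (algebraMap (↥(maximalRealSubfield L)) L) =
      v.1 := by
    rw [mk_embedding]; exact cmPlaceOver_comap L v
  have hre : ∀ j, embedding_of_isReal v.2 (cmRealVec L dW hdW j) = ((cmPlaceOver L v).1.embedding (dW j)).re :=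
    fun j => by rw [← embedding_of_isReal_cmRealVec L v _ hτ dW hdW j, Complex.ofReal_re]
  obtain ⟨j₀, h⟩ := hWr (cmPlaceOver L v).1.embedding
  refine ⟨j₀, h.imp (fun h j hj => ?_) fun h j hj => ?_⟩ <;> rw [hre] <;> exact h j hj

/-- **Theta majorants for the second factor at the CM pin** (`F = L⁺`, `E = L`, the chosen compatible splitting
`cmPairSplitting`): if through every complex embedding `τ` of `L` all but at most one of the (real, non-zero) numbers
`τ(d_W j)` have a common strict sign, then `u ↦ ω_ψ(s_pair(1, u))`, `u ∈ U(diag d_W)(𝔸_{L⁺})`, `HasThetaMajorants` —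
whatever the signatures of `V`.
[cite: Weil1964, Chap. III n° 41 Lemme 5 p. 194, Théorème 6 (1) p. 193]
[cite: GelbartRogawski1991, §3.1 Prop. 3.1.1 p. 455]
[cite: KonnoKonno2007, §3.1 (3.1)]
[cite: MoeglinVignerasWaldspurger1987, Ch. 1 I.17]
[cite: Folland1989, §4.2 (4.24)–(4.26) pp. 177–178, Prop. (4.39) pp. 183–184]
[cite: Knapp2002, Thm 7.39] -/
theorem hasThetaMajorants_cmPairSplitting_inr_of_signs
    (hGR : (GelbartRogawski1991.UnitaryDualPair.cmSplittingDatum L e dV hdV hdV0 dW hdW hdW0).CompatibleSplitting)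
    (hWr : ∀ τ : L →+* ℂ, ∃ j₀ : Fin M, (∀ j, j ≠ j₀ → 0 < (τ (dW j)).re) ∨ ∀ j, j ≠ j₀ → (τ (dW j)).re < 0) :
    HasThetaMajorants fun
      (u : ↥(UnitaryGroup.adelic (↥(maximalRealSubfield L)) L (IsCMField.complexConj L) M (Matrix.diagonal dW)))
      (Φ : piSchwartzBruhat (↥(maximalRealSubfield L)) (Fin n)) =>
        adelicMpCont.omega (↥(maximalRealSubfield L)) (Fin n)
          (GelbartRogawski1991.UnitaryDualPair.adelicGram (↥(maximalRealSubfield L)) e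
            (GelbartRogawski1991.UnitaryDualPair.realDiagonal L dV hdV)
            (GelbartRogawski1991.UnitaryDualPair.realDiagonal L dW hdW))
          (GelbartRogawski1991.UnitaryDualPair.cmPairSplitting L e dV hdV hdV0 dW hdW hdW0 hGR (1, u)) Φ :=
  hasThetaMajorants_omega_pairSplitting_inr_of_signs L (IsCMField.complexConj L) N M e (cmRealVec L dV hdV)
    (cmRealVec L dW hdW) (GelbartRogawski1991.UnitaryDualPair.realDiagonal_map L dV hdV).symm
    (GelbartRogawski1991.UnitaryDualPair.realDiagonal_map L dW hdW).symm
    (GelbartRogawski1991.UnitaryDualPair.complexConj_imagUnit L)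
    (GelbartRogawski1991.UnitaryDualPair.imagUnit_ne_zero L)
    (GelbartRogawski1991.UnitaryDualPair.imagUnit_mul_self L)
    (GelbartRogawski1991.UnitaryDualPair.realDiagonal_isSymm L dV hdV)
    (GelbartRogawski1991.UnitaryDualPair.realDiagonal_isSymm L dW hdW)
    (IsCMField.complexConj_ne_one L) (cmPlaceOver L) (cmPlaceOver_smul L) (cmPlaceOver_comap L)
    (GelbartRogawski1991.UnitaryDualPair.isUnit_det_realDiagonal L dV hdV hdV0)
    (GelbartRogawski1991.UnitaryDualPair.isUnit_det_realDiagonal L dW hdW hdW0)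
    (rank_of_embeddings L dW hdW hWr)
    (GelbartRogawski1991.UnitaryDualPair.splittingOf_isCompatible _ _ _ _ _ _ _ _ _ _ _ _ _ _ _ _ _ hGR)
    (GelbartRogawski1991.UnitaryDualPair.continuous_splittingOf _ _ _ _ _ _ _ _ _ _ _ _ _ _ _ _ _ hGR)

/-- **Lemme 5 for the second factor at the CM pin**: under the same sign fact on `d_W` (nothing on `d_V`), for every
`Φ ∈ 𝒮(𝔸ⁿ)` and every compact `C ⊆ U(diag d_W)(𝔸_{L⁺})` ONE real non-negative `Φ₀ ∈ 𝒮(𝔸ⁿ)` dominates all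
`ω_ψ(s_pair(1, u))Φ`, `u ∈ C`.
[cite: Weil1964, Chap. III n° 41, Lemme 5 p. 194]
[cite: Weil1965, Chap. V n° 47, n° 50]
[cite: GelbartRogawski1991, §3.1 Prop. 3.1.1 p. 455]
[cite: KonnoKonno2007, §3.1 (3.1)]
[cite: MoeglinVignerasWaldspurger1987, Ch. 1 I.17]
[cite: Folland1989, §4.2 (4.24)–(4.26) pp. 177–178, Prop. (4.39) pp. 183–184]
[cite: Knapp2002, Thm 7.39] -/
theorem exists_piSchwartzBruhat_dominating_cmPairSplitting_inr_of_signs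
    (hGR : (GelbartRogawski1991.UnitaryDualPair.cmSplittingDatum L e dV hdV hdV0 dW hdW hdW0).CompatibleSplitting)
    (hWr : ∀ τ : L →+* ℂ, ∃ j₀ : Fin M, (∀ j, j ≠ j₀ → 0 < (τ (dW j)).re) ∨ ∀ j, j ≠ j₀ → (τ (dW j)).re < 0)
    (Φ : piSchwartzBruhat (↥(maximalRealSubfield L)) (Fin n))
    {C : Set ↥(UnitaryGroup.adelic (↥(maximalRealSubfield L)) L (IsCMField.complexConj L) M (Matrix.diagonal dW))}
    (hC : IsCompact C) :
    ∃ Φ₀ : (Fin n → AdeleRing (𝓞 ↥(maximalRealSubfield L)) ↥(maximalRealSubfield L)) → ℂ,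
      Φ₀ ∈ piSchwartzBruhat (↥(maximalRealSubfield L)) (Fin n) ∧ (∀ x, (Φ₀ x).im = 0 ∧ 0 ≤ (Φ₀ x).re) ∧
        ∀ u ∈ C, ∀ x, ‖((adelicMpCont.omega (↥(maximalRealSubfield L)) (Fin n)
          (GelbartRogawski1991.UnitaryDualPair.adelicGram (↥(maximalRealSubfield L)) e
            (GelbartRogawski1991.UnitaryDualPair.realDiagonal L dV hdV)
            (GelbartRogawski1991.UnitaryDualPair.realDiagonal L dW hdW))
          (GelbartRogawski1991.UnitaryDualPair.cmPairSplitting L e dV hdV hdV0 dW hdW hdW0 hGR (1, u)) Φ :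
            piSchwartzBruhat (↥(maximalRealSubfield L)) (Fin n)) :
              (Fin n → AdeleRing (𝓞 ↥(maximalRealSubfield L)) ↥(maximalRealSubfield L)) → ℂ) x‖ ≤ (Φ₀ x).re :=
  exists_piSchwartzBruhat_dominating_omega_pairSplitting_inr_of_signs L (IsCMField.complexConj L) N M e
    (cmRealVec L dV hdV) (cmRealVec L dW hdW) (GelbartRogawski1991.UnitaryDualPair.realDiagonal_map L dV hdV).symm
    (GelbartRogawski1991.UnitaryDualPair.realDiagonal_map L dW hdW).symm
    (GelbartRogawski1991.UnitaryDualPair.complexConj_imagUnit L)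
    (GelbartRogawski1991.UnitaryDualPair.imagUnit_ne_zero L)
    (GelbartRogawski1991.UnitaryDualPair.imagUnit_mul_self L)
    (GelbartRogawski1991.UnitaryDualPair.realDiagonal_isSymm L dV hdV)
    (GelbartRogawski1991.UnitaryDualPair.realDiagonal_isSymm L dW hdW)
    (IsCMField.complexConj_ne_one L) (cmPlaceOver L) (cmPlaceOver_smul L) (cmPlaceOver_comap L)
    (GelbartRogawski1991.UnitaryDualPair.isUnit_det_realDiagonal L dV hdV hdV0)
    (GelbartRogawski1991.UnitaryDualPair.isUnit_det_realDiagonal L dW hdW hdW0)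
    (rank_of_embeddings L dW hdW hWr)
    (GelbartRogawski1991.UnitaryDualPair.splittingOf_isCompatible _ _ _ _ _ _ _ _ _ _ _ _ _ _ _ _ _ hGR)
    (GelbartRogawski1991.UnitaryDualPair.continuous_splittingOf _ _ _ _ _ _ _ _ _ _ _ _ _ _ _ _ _ hGR) Φ hC

end CM

/-! ## §3 A hermitian PLANE (`M = 2`): no sign hypothesis at all -/

section CMPlane

variable (L : Type) [Field L] [NumberField L] [IsCMField L] {N n : ℕ} (e : Fin N × Fin 2 ≃ Fin n)
  (dV : Fin N → L) (hdV : ∀ i, IsCMField.complexConj L (dV i) = dV i) (hdV0 : ∀ i, dV i ≠ 0)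
  (dW : Fin 2 → L) (hdW : ∀ i, IsCMField.complexConj L (dW i) = dW i) (hdW0 : ∀ i, dW i ≠ 0)

include hdW hdW0 in
/-- a non-degenerate real BINARY form has real rank `≤ 1`: with `j₀ := 1` the condition is the sign of `τ(d_W 0)`.
[folklore] -/
private theorem rank_two (τ : L →+* ℂ) :
    ∃ j₀ : Fin 2, (∀ j, j ≠ j₀ → 0 < (τ (dW j)).re) ∨ ∀ j, j ≠ j₀ → (τ (dW j)).re < 0 := by
  refine ⟨1, ?_⟩
  rcases lt_or_gt_of_ne (re_apply_ne_zero_of_complexConj_eq L τ (hdW 0) (hdW0 0)) with h | h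
  · refine Or.inr fun j hj => ?_
    fin_cases j
    · exact h
    · exact absurd rfl hj
  · refine Or.inl fun j hj => ?_
    fin_cases j
    · exact h
    · exact absurd rfl hj

/-- **Theta majorants for the second factor, `W` a hermitian PLANE** (`M = 2` — e.g. the doubled line `W ⊕ W⁻`,
of signature `(1,1)` at every real place): `u ↦ ω_ψ(s_pair(1, u))` `HasThetaMajorants` with NO sign hypothesis on
`d_V` or `d_W`.
[cite: Weil1964, Chap. III n° 41 Lemme 5 p. 194, Théorème 6 (1) p. 193]
[cite: GelbartRogawski1991, §3.1 Prop. 3.1.1 p. 455]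
[cite: KonnoKonno2007, §3.1 (3.1)]
[cite: MoeglinVignerasWaldspurger1987, Ch. 1 I.17]
[cite: Folland1989, §4.2 (4.24)–(4.26) pp. 177–178, Prop. (4.39) pp. 183–184]
[cite: Knapp2002, Thm 7.39] -/
theorem hasThetaMajorants_cmPairSplitting_inr_two
    (hGR : (GelbartRogawski1991.UnitaryDualPair.cmSplittingDatum L e dV hdV hdV0 dW hdW hdW0).CompatibleSplitting) :
    HasThetaMajorants fun
      (u : ↥(UnitaryGroup.adelic (↥(maximalRealSubfield L)) L (IsCMField.complexConj L) 2 (Matrix.diagonal dW)))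
      (Φ : piSchwartzBruhat (↥(maximalRealSubfield L)) (Fin n)) =>
        adelicMpCont.omega (↥(maximalRealSubfield L)) (Fin n)
          (GelbartRogawski1991.UnitaryDualPair.adelicGram (↥(maximalRealSubfield L)) e
            (GelbartRogawski1991.UnitaryDualPair.realDiagonal L dV hdV)
            (GelbartRogawski1991.UnitaryDualPair.realDiagonal L dW hdW))
          (GelbartRogawski1991.UnitaryDualPair.cmPairSplitting L e dV hdV hdV0 dW hdW hdW0 hGR (1, u)) Φ :=
  hasThetaMajorants_cmPairSplitting_inr_of_signs L e dV hdV hdV0 dW hdW hdW0 hGR (rank_two L dW hdW hdW0)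

/-- **Lemme 5 for the second factor, `W` a hermitian PLANE — the (DOM-C) letter of the Siegel–Weil engine**: for the
CM dual pair `(U(diag d_V), U(diag d_W))` with `W` a plane (ANY `d_V`, ANY non-degenerate `d_W`: no sign
hypothesis), every `Φ ∈ 𝒮(𝔸ⁿ)` and every compact `C ⊆ U(diag d_W)(𝔸_{L⁺})`, ONE real non-negative `Φ₀ ∈ 𝒮(𝔸ⁿ)`
satisfies `‖(ω_ψ(s_pair(1, u))Φ)(x)‖ ≤ (Φ₀ x).re` for all `u ∈ C`, `x ∈ 𝔸ⁿ`.
[cite: Weil1964, Chap. III n° 41, Lemme 5 p. 194]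
[cite: Weil1965, Chap. V n° 47, n° 50]
[cite: GelbartRogawski1991, §3.1 Prop. 3.1.1 p. 455]
[cite: KonnoKonno2007, §3.1 (3.1)]
[cite: MoeglinVignerasWaldspurger1987, Ch. 1 I.17]
[cite: Folland1989, §4.2 (4.24)–(4.26) pp. 177–178, Prop. (4.39) pp. 183–184]
[cite: Knapp2002, Thm 7.39] -/
theorem exists_piSchwartzBruhat_dominating_cmPairSplitting_inr_two
    (hGR : (GelbartRogawski1991.UnitaryDualPair.cmSplittingDatum L e dV hdV hdV0 dW hdW hdW0).CompatibleSplitting)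
    (Φ : piSchwartzBruhat (↥(maximalRealSubfield L)) (Fin n))
    {C : Set ↥(UnitaryGroup.adelic (↥(maximalRealSubfield L)) L (IsCMField.complexConj L) 2 (Matrix.diagonal dW))}
    (hC : IsCompact C) :
    ∃ Φ₀ : (Fin n → AdeleRing (𝓞 ↥(maximalRealSubfield L)) ↥(maximalRealSubfield L)) → ℂ,
      Φ₀ ∈ piSchwartzBruhat (↥(maximalRealSubfield L)) (Fin n) ∧ (∀ x, (Φ₀ x).im = 0 ∧ 0 ≤ (Φ₀ x).re) ∧
        ∀ u ∈ C, ∀ x, ‖((adelicMpCont.omega (↥(maximalRealSubfield L)) (Fin n)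
          (GelbartRogawski1991.UnitaryDualPair.adelicGram (↥(maximalRealSubfield L)) e
            (GelbartRogawski1991.UnitaryDualPair.realDiagonal L dV hdV)
            (GelbartRogawski1991.UnitaryDualPair.realDiagonal L dW hdW))
          (GelbartRogawski1991.UnitaryDualPair.cmPairSplitting L e dV hdV hdV0 dW hdW hdW0 hGR (1, u)) Φ :
            piSchwartzBruhat (↥(maximalRealSubfield L)) (Fin n)) :
              (Fin n → AdeleRing (𝓞 ↥(maximalRealSubfield L)) ↥(maximalRealSubfield L)) → ℂ) x‖ ≤ (Φ₀ x).re :=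
  exists_piSchwartzBruhat_dominating_cmPairSplitting_inr_of_signs L e dV hdV hdV0 dW hdW hdW0 hGR
    (rank_two L dW hdW hdW0) Φ hC

end CMPlane

end Literature.NumberTheory.Weil1964

end
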